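import Mathlib
import Literature.Probability.LatticeModels.GKSInequalities
import Summits.CriticalPhenomena.Ising3DConformalLimit.Theorems.PrecisionLaplacianInverseMFerromagnetEntryNonposOfPcov
import Summits.CriticalPhenomena.Ising3DConformalLimit.Theorems.PrecisionLaplacianInverseMFerromagnetCondExpEqFrozen
import Summits.CriticalPhenomena.Ising3DConformalLimit.Theorems.PrecisionLaplacianInverseMFerromagnetCondCovNonneg
import Summits.CriticalPhenomena.Ising3DConformalLimit.Theorems.PrecisionLaplacianInverseMFerromagnetLevelTwo
import Summits.CriticalPhenomena.Ising3DConformalLimit.Theorems.PrecisionLaplacianInverseMFerromagnetGhsPm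
import Summits.CriticalPhenomena.Ising3DConformalLimit.Theorems.PrecisionLaplacianInverseMFerromagnetLevelThree
import Summits.CriticalPhenomena.Ising3DConformalLimit.Theorems.PrecisionLaplacianInverseMFerromagnetLevelLeOne
import HarnessLib

/-!
# Crux `PrecisionLaplacian.InverseMFerromagnet` (stmt-CriticalPhenomena-4798), line `Sketch` —
# stub `helper_im_le_five`: IM for every zero-field pair ferromagnet on at most five sites

THEOREM-ONLY file (no definitions).  Let `Σ = (⟨σ_pσ_q⟩)_{p,q}` be the spin second-moment matrix
of the zero-field pair ferromagnet `gksExpect univ K C` (`K ≥ 0`, `|C i| = 2`) on the sites `Fin n`.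
The crux IM says `(Σ⁻¹)_xy ≤ 0` for all `x ≠ y`.  This file proves it unconditionally for `n ≤ 5`:
it is the dividend of the partial-covariance ladder of the line, levels `≤ 3`, all of which are
landed kernel facts of this namespace.

Proof.  Put `S = univ ∖ {x,y}`, so `|S| = n − 2 ≤ 3`.  The ladder gives
`PCov(x,y|S) = Σ_xy − Σ_{xS}(Σ_SS)⁻¹Σ_{Sy} ≥ 0`: level `≤ 1` is `pcov_nonneg_of_card_le_one`
(GKS I/II), level `2` is `stub_level_two` fed with the conditional-covariance inequality
`stub_condCov_nonneg`, level `3` is `stub_level_three` fed with conditioning = freezing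
(`stub_condExp_eq_frozen`), `stub_condCov_nonneg`, and GHS with sign flips (`stub_ghs_pm`).  The Schur
step `stub_entry_nonpos_of_pcov` turns `PCov(x,y|S) ≥ 0` into `(Σ⁻¹)_xy ≤ 0`.
-/

namespace Summit.CriticalPhenomena.Ising3DConformalLimit.Cruxes.InverseMFerromagnet.PartialCovarianceLadder

open Literature.Probability.LatticeModels Finset Matrix

/-- **IM for every zero-field pair ferromagnet on `n ≤ 5` sites**: every off-diagonal entry of the
inverse of the second-moment matrix `(⟨σ_pσ_q⟩)` is `≤ 0`.  Corollary of the partial-covariance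
ladder (level `≤ 1`, `stub_level_two` fed `stub_condCov_nonneg`, `stub_level_three` fed
`stub_condExp_eq_frozen`/`stub_condCov_nonneg`/`stub_ghs_pm`) and the Schur step
`stub_entry_nonpos_of_pcov`, since `univ ∖ {x,y}` has at most three elements. [folklore] -/
theorem helper_im_le_five :
    ∀ (n m : ℕ) (K : Fin m → ℝ) (C : Fin m → Finset (Fin n)), n ≤ 5 → (∀ i, 0 ≤ K i) → (∀ i, (C i).card = 2) →
      ∀ x y : Fin n, x ≠ y →
        (Matrix.of fun p q : Fin n => gksExpect Finset.univ K C (fun ω => spinAt p ω * spinAt q ω))⁻¹ x y ≤ 0 := by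
  intro n m K C hn hK hC x y hxy
  set G : Matrix (Fin n) (Fin n) ℝ :=
    Matrix.of (fun p q : Fin n => gksExpect Finset.univ K C (fun ω => spinAt p ω * spinAt q ω)) with hG
  set S : Finset (Fin n) := (Finset.univ.erase x).erase y with hS
  have hx : x ∉ S := by simp [hS]
  have hy : y ∉ S := by simp [hS, hxy.symm]
  have hcard : S.card ≤ 3 := by
    have h1 : S.card = (Finset.univ.erase x).card - 1 :=
      Finset.card_erase_of_mem (by simp [hxy.symm])
    have h2 : (Finset.univ.erase x).card = (Finset.univ : Finset (Fin n)).card - 1 :=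
      Finset.card_erase_of_mem (by simp)
    simp only [Finset.card_univ, Fintype.card_fin] at h2
    omega
  have hpc : 0 ≤ G x y - ∑ p : ↥S, ∑ q : ↥S,
      G x p.1 * (G.submatrix (Subtype.val : ↥S → Fin n) (Subtype.val : ↥S → Fin n))⁻¹ p q * G q.1 y := by
    rcases Nat.lt_or_ge S.card 2 with h2 | h2
    · exact pcov_nonneg_of_card_le_one n m K C hK hC G hG x y S hxy hx hy (by omega)
    rcases Nat.lt_or_ge S.card 3 with h3 | h3
    · exact stub_level_two stub_condCov_nonneg n m K C hK hC G hG x y S hxy hx hy (by omega)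
    · exact stub_level_three stub_condExp_eq_frozen stub_condCov_nonneg stub_ghs_pm
        n m K C hK hC G hG x y S hxy hx hy (by omega)
  exact stub_entry_nonpos_of_pcov n m K C hK hC G hG x y S hxy hS hpc

end Summit.CriticalPhenomena.Ising3DConformalLimit.Cruxes.InverseMFerromagnet.PartialCovarianceLadder
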